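import Summits.KontsevichZagierPeriods.KontsevichZagierPeriods.Theses.FermatIsogeny
import Summits.KontsevichZagierPeriods.KontsevichZagierPeriods.Theorems.FermatIsogenyBetaLinearSectorThirds
import Summits.KontsevichZagierPeriods.KontsevichZagierPeriods.Theorems.TorsionLogsGKZLevelThreePairBetaEulerReflection
import Summits.KontsevichZagierPeriods.KontsevichZagierPeriods.Theorems.BetaCancellation.Negative.EulerReflectionStub
import Literature.NumberTheory.Transcendental.KZProduct

/-!
# `BetaLinearSector` on the UNION of the half-integer and third-integer sectors, UNCONDITIONALLY (cross-level pairs)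

Crux `BetaLinearSector` (stmt-KontsevichZagierPeriods-3897, route FermatIsogeny): two one-dimensional Kontsevich–Zagier representations
pinned on `(0,1)` as `[t^{a-1}(1-t)^{b-1}]` and `[c·t^{a'-1}(1-t)^{b'-1}]` with the same value are KZ-equivalent.  The landed rungs prove it for
`a, b, a', b' ∈ ½ℤ` (`HalfIntegers.betaLinearSector_halfIntegers`, Lindemann) and for `a, b, a', b' ∈ ⅓ℤ` (`Thirds.betaLinearSector_thirds`,
Chudnovsky).  THIS file proves the registered anchor `betaLinearSector_halvesThirds`: EACH pair `(a,b)`, `(a',b')` lies in `½ℤ²` OR in `⅓ℤ²`,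
the two pairs possibly at different levels.  The one new ingredient is the CROSS-LEVEL `π`-BRIDGE `B(1/2,1/2) = π = sin(π/3)·B(1/3,2/3)`
inside the calculus: both cells are a chain of moves away from the closed unit disc (`stubEulerReflection_half` and the landed
`GKZLevelThree.eulerReflectionRational_one_third`), so the level-`2` `π`-cell normalises onto the canonical level-`3` cell
`T₁ = [(√3/2)·β(1/3,2/3)]` (`halfHalf_equivalent_T1`).  With that, every base cell of either level has a NORMAL FORM `(c q)·T_i` over the four
canonical cells of the third-integer rung (`normalForm_union`), whose value classes `v = (1, π, Γ(1/3)³/π, π²/Γ(1/3)³)` are separated by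
`Thirds.v_sep`; the level reductions are the landed `P_of_base_left_half` / `P_of_base_left_third`.

References: M. Kontsevich, D. Zagier, *Periods* (2001), §1.2; G. E. Andrews, R. Askey, R. Roy, *Special Functions* (1999), §1.1, Thm 1.2.1;
G. V. Chudnovsky, *Contributions to the theory of transcendental numbers* (1984), Ch. 7 §2.
-/

noncomputable section

namespace Summit.KontsevichZagierPeriods.FermatIsogeny.BetaLinearSector.HalvesThirds

open MeasureTheory Set Literature.NumberTheory.Transcendental Literature.NumberTheory.Transcendental.KZ HalfIntegers
open Summit.KontsevichZagierPeriods.FermatIsogeny.BetaLinearSector.Thirds (normalForm v_sep v_pos nf_a_one third_cases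
  P_of_base_left_third)
open Summit.KontsevichZagierPeriods.KontsevichZagierPeriods.Theorems.GKZLevelThree (eulerReflectionRational_one_third)
open Summit.KontsevichZagierPeriods.KontsevichZagierPeriods.BetaCancellationNegative (stubEulerReflection_half)

set_option quotPrecheck false in
/-- `r` is PINNED as `[(0,1), c · t^{a-1}(1-t)^{b-1}]` (the two hypotheses on each representation in the crux, with a constant). -/
local notation "Pinned⟦" c ", " a ", " b ", " r "⟧" =>
  (IntegralRep.domain r = {x : Fin 1 → ℝ | x 0 ∈ Set.Ioo (0:ℝ) 1} ∧
    Set.EqOn (IntegralRep.integrand r) (fun x : Fin 1 → ℝ => (c : ℝ) * (x 0) ^ (((a : ℚ) : ℝ) - 1) * (1 - x 0) ^ (((b : ℚ) : ℝ) - 1))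
      (IntegralRep.domain r))

set_option quotPrecheck false in
/-- The two-sided, constant-carrying form of the crux for fixed exponents. -/
local notation "P⟦" a ", " b ", " a' ", " b' "⟧" =>
  (∀ (c c' : ℝ) (r r' : IntegralRep 1), IsAlgebraic ℚ c → IsAlgebraic ℚ c' →
    Pinned⟦c, a, b, r⟧ → Pinned⟦c', a', b', r'⟧ → IntegralRep.value r = IntegralRep.value r' → Equivalent r r')

set_option quotPrecheck false in
/-- The four CLASS VALUES of the third-integer rung: `v = (1, π, Γ(1/3)³/π, π²/Γ(1/3)³)` (a notation, not a definition). -/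
local notation "v" => (![1, Real.pi, Real.Gamma (1/3) ^ 3 / Real.pi, Real.pi ^ 2 / Real.Gamma (1/3) ^ 3] : Fin 4 → ℝ)

set_option quotPrecheck false in
/-- A base cell of the half-integer window. -/
local notation "HalfBase⟦" a ", " b "⟧" => ((a = 1 / 2 ∨ a = 1) ∧ (b = 1 / 2 ∨ b = 1))

set_option quotPrecheck false in
/-- A base cell of the third-integer window. -/
local notation "ThirdBase⟦" a ", " b "⟧" => ((a = 1 / 3 ∨ a = 2 / 3 ∨ a = 1) ∧ (b = 1 / 3 ∨ b = 2 / 3 ∨ b = 1))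

/-! ## The cross-level `π`-bridge -/

/-- **`B(1/2,1/2) = sin(π/3)·B(1/3,2/3)` inside the rules**: a cell pinned as `[c·β(1/2,1/2)]` is a chain of moves away from `c·T₁`,
`T₁ = [(√3/2)·β(1/3,2/3)]` — both are equivalent to (multiples of) the closed unit disc `[π]` by Euler's reflection at `1/2`
(`stubEulerReflection_half`) and at `1/3` (`GKZLevelThree.eulerReflectionRational_one_third`). [cite: KontsevichZagier2001, §1.2]
[cite: AndrewsAskeyRoy1999, Thm 1.2.1] -/
theorem halfHalf_equivalent_T1 {c : ℝ} (hc : IsAlgebraic ℚ c) {r T : IntegralRep 1} (hr : Pinned⟦c, (1/2 : ℚ), (1/2 : ℚ), r⟧)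
    (hT : Pinned⟦(Real.sqrt 3 / 2), (1/3 : ℚ), (2/3 : ℚ), T⟧) (hk : IsAlgebraic ℚ (c * 1)) : Equivalent r (T.constMul (c * 1) hk) := by
  obtain ⟨β, hβ⟩ := exists_pinned 1 isAlgebraic_one (by norm_num : (0:ℚ) < 1/2) (by norm_num : (0:ℚ) < 1/2)
  have e₁ : Equivalent r (β.constMul c hc) := equivalent_constMul_of_pinned hc hr hβ (mul_one c).symm
  have e₂ : Equivalent β piRep := by
    refine stubEulerReflection_half β piRep hβ.1 (fun x hx => ?_) rfl (fun _ _ => rfl)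
    rw [hβ.2 hx, show Real.pi * ((1/2 : ℚ) : ℝ) = Real.pi / 2 by push_cast; ring, Real.sin_pi_div_two]
    norm_num
  have e₃ : Equivalent T piRep := by
    refine eulerReflectionRational_one_third T piRep hT.1 (fun x hx => ?_) rfl (fun _ _ => rfl)
    rw [hT.2 hx, show Real.pi * ((1/3 : ℚ) : ℝ) = Real.pi / 3 by push_cast; ring, Real.sin_pi_div_three]
    norm_num
  refine e₁.trans (((e₂.trans e₃.symm).constMul c hc).trans ?_)
  exact of_sub_of_mem_relations_of_eqOn rfl fun x _ => by simp only [IntegralRep.integrand_constMul, mul_one]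

/-! ## Normal forms over the canonical cells of the third-integer rung -/

/-- NORMAL FORM of the four half-integer base cells over the canonical cells `T₀ = [β(1,1)]`, `T₁ = [(√3/2)β(1/3,2/3)]` of the third-integer
rung: the rational cells through `Thirds.nf_a_one` (and a swap), the `π`-cell through `halfHalf_equivalent_T1`. [cite: KontsevichZagier2001, §1.2] -/
theorem normalForm_half {c : ℝ} (hc : IsAlgebraic ℚ c) {a b : ℚ} (hab : HalfBase⟦a, b⟧) {r : IntegralRep 1} (hr : Pinned⟦c, a, b, r⟧)
    (T : Fin 4 → IntegralRep 1) (hT0 : Pinned⟦(1 : ℝ), (1 : ℚ), (1 : ℚ), T 0⟧)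
    (hT1 : Pinned⟦(Real.sqrt 3 / 2), (1/3 : ℚ), (2/3 : ℚ), T 1⟧) :
    ∃ (i : Fin 4) (q : ℝ) (hk : IsAlgebraic ℚ (c * q)), 0 < q ∧ Equivalent r ((T i).constMul (c * q) hk) ∧ r.value = c * q * v i := by
  obtain ⟨ha, hb⟩ := hab
  rcases hb with rfl | rfl
  · rcases ha with rfl | rfl
    · -- (1/2, 1/2): the π-cell
      have hk : IsAlgebraic ℚ (c * 1) := by simpa using hc
      refine ⟨1, 1, hk, one_pos, halfHalf_equivalent_T1 hc hr hT1 hk, ?_⟩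
      rw [value_half_half hr]
      simp
    · -- (1, 1/2): swap, then the rational class
      obtain ⟨ρ, hρ⟩ := exists_pinned c hc (by norm_num : (0:ℚ) < 1/2) (by norm_num : (0:ℚ) < 1)
      have e : Equivalent r ρ := pinned_swap hc (by norm_num) (by norm_num) hr hρ
      obtain ⟨q, hk, hq, e', hval⟩ := nf_a_one hc (by norm_num) hρ hT0
      exact ⟨0, q, hk, hq, e.trans e', by rw [Equivalent.value_eq_holds e, hval]⟩
  · rcases ha with rfl | rfl
    · exact ⟨0, nf_a_one hc (by norm_num) hr hT0⟩
    · exact ⟨0, nf_a_one hc (by norm_num) hr hT0⟩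

/-- NORMAL FORM on the union of the two base windows (dispatch to `normalForm_half` / `Thirds.normalForm`). [cite: KontsevichZagier2001, §1.2] -/
theorem normalForm_union {c : ℝ} (hc : IsAlgebraic ℚ c) {a b : ℚ} (hab : HalfBase⟦a, b⟧ ∨ ThirdBase⟦a, b⟧) {r : IntegralRep 1}
    (hr : Pinned⟦c, a, b, r⟧) (T : Fin 4 → IntegralRep 1) (hT0 : Pinned⟦(1 : ℝ), (1 : ℚ), (1 : ℚ), T 0⟧)
    (hT1 : Pinned⟦(Real.sqrt 3 / 2), (1/3 : ℚ), (2/3 : ℚ), T 1⟧) (hT2 : Pinned⟦(2 / Real.sqrt 3), (1/3 : ℚ), (1/3 : ℚ), T 2⟧)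
    (hT3 : Pinned⟦(1/4 : ℝ), (2/3 : ℚ), (2/3 : ℚ), T 3⟧) :
    ∃ (i : Fin 4) (q : ℝ) (hk : IsAlgebraic ℚ (c * q)), 0 < q ∧ Equivalent r ((T i).constMul (c * q) hk) ∧ r.value = c * q * v i := by
  rcases hab with h | ⟨ha, hb⟩
  · exact normalForm_half hc h hr T hT0 hT1
  · exact normalForm hc ha hb hr T hT0 hT1 hT2 hT3

/-! ## The base of the union sector and the assembly -/

/-- **The base of the union sector**: `P⟦a, b, a', b'⟧` whenever each pair is a base cell of the half-integer OR of the third-integer window —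
same class ⇒ same multiple of the same canonical cell, different classes ⇒ no common value (`Thirds.v_sep`, Chudnovsky), degenerate constants ⇒
two zero representations. [cite: KontsevichZagier2001, §1.2] [cite: Chudnovsky1984, Ch. 7 §2 Cor. 2.3] -/
theorem P_base_union {a b a' b' : ℚ} (hab : HalfBase⟦a, b⟧ ∨ ThirdBase⟦a, b⟧) (hab' : HalfBase⟦a', b'⟧ ∨ ThirdBase⟦a', b'⟧) :
    P⟦a, b, a', b'⟧ := by
  have hpos : ∀ {p q : ℚ}, (HalfBase⟦p, q⟧ ∨ ThirdBase⟦p, q⟧) → 0 < p ∧ 0 < q := by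
    rintro p q (⟨hp, hq⟩ | ⟨hp, hq⟩)
    · rcases hp with rfl | rfl <;> rcases hq with rfl | rfl <;> norm_num
    · rcases hp with rfl | rfl | rfl <;> rcases hq with rfl | rfl | rfl <;> norm_num
  intro c c' r r' hc hc' hr hr' hv
  have hvr := value_of_pinned hr (hpos hab).1 (hpos hab).2
  have hvr' := value_of_pinned hr' (hpos hab').1 (hpos hab').2
  have hBpos : ∀ {p q : ℚ}, 0 < p → 0 < q →
      0 < Real.Gamma (p:ℝ) * Real.Gamma (q:ℝ) / Real.Gamma ((p:ℝ) + (q:ℝ)) := fun {p q} hp hq => by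
    have hpR : (0:ℝ) < p := by exact_mod_cast hp
    have hqR : (0:ℝ) < q := by exact_mod_cast hq
    exact div_pos (mul_pos (Real.Gamma_pos_of_pos hpR) (Real.Gamma_pos_of_pos hqR)) (Real.Gamma_pos_of_pos (by linarith))
  -- the degenerate constants
  by_cases hc0 : c = 0
  · have hc'0 : c' = 0 := by
      have h0 : c' * (Real.Gamma (a':ℝ) * Real.Gamma (b':ℝ) / Real.Gamma ((a':ℝ) + (b':ℝ))) = 0 := by
        rw [← hvr', ← hv, hvr, hc0, zero_mul]
      exact (mul_eq_zero.1 h0).resolve_right (hBpos (hpos hab').1 (hpos hab').2).ne'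
    have h1 : of r ∈ relations := of_mem_relations_of_eqOn_zero r fun x hx => by
      rw [hr.2 hx]
      simp [hc0]
    have h2 : of r' ∈ relations := of_mem_relations_of_eqOn_zero r' fun x hx => by
      rw [hr'.2 hx]
      simp [hc'0]
    exact relations.sub_mem h1 h2
  have hc'0 : c' ≠ 0 := by
    intro h
    have h0 : c * (Real.Gamma (a:ℝ) * Real.Gamma (b:ℝ) / Real.Gamma ((a:ℝ) + (b:ℝ))) = 0 := by
      rw [← hvr, hv, hvr', h, zero_mul]
    exact hc0 ((mul_eq_zero.1 h0).resolve_right (hBpos (hpos hab).1 (hpos hab).2).ne')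
  -- the four canonical cells of the third-integer rung
  have hs : 0 < Real.sqrt 3 := Real.sqrt_pos.2 (by norm_num)
  have hsA : IsAlgebraic ℚ (Real.sqrt 3) := by
    refine ⟨Polynomial.X ^ 2 - Polynomial.C 3, Polynomial.X_pow_sub_C_ne_zero (by norm_num) 3, ?_⟩
    simp [Real.sq_sqrt (show (0:ℝ) ≤ 3 by norm_num)]
  obtain ⟨T0, hT0⟩ := exists_pinned (1 : ℝ) isAlgebraic_one (by norm_num : (0:ℚ) < 1) (by norm_num : (0:ℚ) < 1)
  obtain ⟨T1, hT1⟩ := exists_pinned (Real.sqrt 3 / 2) (by simpa [div_eq_mul_inv] using hsA.mul (isAlgebraic_rat ℚ 2).inv)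
    (by norm_num : (0:ℚ) < 1/3) (by norm_num : (0:ℚ) < 2/3)
  obtain ⟨T2, hT2⟩ := exists_pinned (2 / Real.sqrt 3) (by simpa [div_eq_mul_inv] using (isAlgebraic_rat ℚ 2).mul hsA.inv)
    (by norm_num : (0:ℚ) < 1/3) (by norm_num : (0:ℚ) < 1/3)
  obtain ⟨T3, hT3⟩ := exists_pinned (1 / 4 : ℝ) (by simpa using (isAlgebraic_rat ℚ (1/4) : IsAlgebraic ℚ (((1/4 : ℚ)) : ℝ)))
    (by norm_num : (0:ℚ) < 2/3) (by norm_num : (0:ℚ) < 2/3)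
  obtain ⟨i, q, hk, hq, e, hval⟩ := normalForm_union hc hab hr ![T0, T1, T2, T3] hT0 hT1 hT2 hT3
  obtain ⟨i', q', hk', hq', e', hval'⟩ := normalForm_union hc' hab' hr' ![T0, T1, T2, T3] hT0 hT1 hT2 hT3
  have h := hv
  rw [hval, hval'] at h
  by_cases hii : i = i'
  · subst hii
    have hcq : c * q = c' * q' := mul_right_cancel₀ (v_pos i).ne' h
    have emid : Equivalent ((![T0, T1, T2, T3] i).constMul (c * q) hk) ((![T0, T1, T2, T3] i).constMul (c' * q') hk') :=
      of_sub_of_mem_relations_of_eqOn rfl fun x _ => by simp only [IntegralRep.integrand_constMul, hcq]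
    exact e.trans (emid.trans e'.symm)
  · exfalso
    have hcq0 : c * q ≠ 0 := mul_ne_zero hc0 hq.ne'
    refine v_sep i i' hii (c' * q' * (c * q)⁻¹) (hk'.mul hk.inv) ?_
    rw [← inv_mul_cancel_left₀ hcq0 (v i), h]
    ring

/-- The base windows, from the integrality type of a pair in `(0,1]²`. [folklore] -/
theorem base_of_half {a b : ℚ} (ha : 0 < a) (ha1 : a ≤ 1) (hb : 0 < b) (hb1 : b ≤ 1) (hma : ∃ m : ℤ, a = m / 2) (hmb : ∃ m : ℤ, b = m / 2) :
    HalfBase⟦a, b⟧ ∨ ThirdBase⟦a, b⟧ :=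
  Or.inl ⟨half_cases ha ha1 hma, half_cases hb hb1 hmb⟩

/-- The base windows, from the integrality type of a pair in `(0,1]²`. [folklore] -/
theorem base_of_third {a b : ℚ} (ha : 0 < a) (ha1 : a ≤ 1) (hb : 0 < b) (hb1 : b ≤ 1) (hma : ∃ m : ℤ, a = m / 3) (hmb : ∃ m : ℤ, b = m / 3) :
    HalfBase⟦a, b⟧ ∨ ThirdBase⟦a, b⟧ :=
  Or.inr ⟨third_cases ha ha1 hma, third_cases hb hb1 hmb⟩

/-- **`P⟦a, b, a', b'⟧` on the union sector**: reduce each pair inside its own level (`P_of_base_left_half` / `P_of_base_left_third`, which keep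
the integrality type), then `P_base_union`. [folklore] -/
theorem P_all_union {a b a' b' : ℚ} (ha : 0 < a) (hb : 0 < b) (ha' : 0 < a') (hb' : 0 < b')
    (h : (∃ m : ℤ, a = m / 2) ∧ (∃ m : ℤ, b = m / 2) ∨ (∃ m : ℤ, a = m / 3) ∧ (∃ m : ℤ, b = m / 3))
    (h' : (∃ m : ℤ, a' = m / 2) ∧ (∃ m : ℤ, b' = m / 2) ∨ (∃ m : ℤ, a' = m / 3) ∧ (∃ m : ℤ, b' = m / 3)) : P⟦a, b, a', b'⟧ := by
  -- the right pair reduced to a base cell, for ANY fixed base cell on the left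
  have right : ∀ {a₀ b₀ : ℚ}, (HalfBase⟦a₀, b₀⟧ ∨ ThirdBase⟦a₀, b₀⟧) → P⟦a₀, b₀, a', b'⟧ := by
    intro a₀ b₀ h₀
    rcases h' with ⟨hma', hmb'⟩ | ⟨hma', hmb'⟩
    · exact P_symm (P_of_base_left_half (a' := a₀) (b' := b₀)
        (fun a₁ b₁ ha₁ ha₁1 hb₁ hb₁1 hma₁ hmb₁ => P_base_union (base_of_half ha₁ ha₁1 hb₁ hb₁1 hma₁ hmb₁) h₀) a' b' ha' hb' hma' hmb')
    · exact P_symm (P_of_base_left_third (a' := a₀) (b' := b₀)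
        (fun a₁ b₁ ha₁ ha₁1 hb₁ hb₁1 hma₁ hmb₁ => P_base_union (base_of_third ha₁ ha₁1 hb₁ hb₁1 hma₁ hmb₁) h₀) a' b' ha' hb' hma' hmb')
  rcases h with ⟨hma, hmb⟩ | ⟨hma, hmb⟩
  · exact P_of_base_left_half (fun a₀ b₀ ha₀ ha₀1 hb₀ hb₀1 hma₀ hmb₀ => right (base_of_half ha₀ ha₀1 hb₀ hb₀1 hma₀ hmb₀))
      a b ha hb hma hmb
  · exact P_of_base_left_third (fun a₀ b₀ ha₀ ha₀1 hb₀ hb₀1 hma₀ hmb₀ => right (base_of_third ha₀ ha₀1 hb₀ hb₀1 hma₀ hmb₀))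
      a b ha hb hma hmb

/-- **`BetaLinearSector` ON THE UNION OF THE HALF-INTEGER AND THIRD-INTEGER SECTORS, UNCONDITIONALLY** (cross-level pairs included): Conjecture 1
of Kontsevich–Zagier for every pair of Beta integrals `[∫₀¹ t^{a-1}(1-t)^{b-1}dt]`, `[∫₀¹ c·t^{a'-1}(1-t)^{b'-1}dt]` with `(a,b) ∈ ½ℕ²_{>0} ∪ ⅓ℕ²_{>0}`,
`(a',b') ∈ ½ℕ²_{>0} ∪ ⅓ℕ²_{>0}`, `c` real algebraic and equal values — the registered anchor `betaLinearSector_halvesThirds` of crux stmt-3897.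
[cite: KontsevichZagier2001, §1.2] [cite: Chudnovsky1984, Ch. 7 §2 Cor. 2.3] -/
theorem betaLinearSector_halvesThirds : ∀ (a b a' b' : ℚ) (c : ℝ), 0 < a → 0 < b → 0 < a' → 0 < b' → IsAlgebraic ℚ c →
    ((∃ m : ℤ, a = m / 2) ∧ (∃ m : ℤ, b = m / 2) ∨ (∃ m : ℤ, a = m / 3) ∧ (∃ m : ℤ, b = m / 3)) →
    ((∃ m : ℤ, a' = m / 2) ∧ (∃ m : ℤ, b' = m / 2) ∨ (∃ m : ℤ, a' = m / 3) ∧ (∃ m : ℤ, b' = m / 3)) →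
    ∀ (r r' : KZ.IntegralRep 1), r.domain = {x | x 0 ∈ Set.Ioo (0:ℝ) 1} →
    Set.EqOn r.integrand (fun x => (x 0) ^ ((a:ℝ) - 1) * (1 - x 0) ^ ((b:ℝ) - 1)) r.domain →
    r'.domain = {x | x 0 ∈ Set.Ioo (0:ℝ) 1} →
    Set.EqOn r'.integrand (fun x => c * (x 0) ^ ((a':ℝ) - 1) * (1 - x 0) ^ ((b':ℝ) - 1)) r'.domain →
    r.value = r'.value → KZ.Equivalent r r' := by
  intro a b a' b' c ha hb ha' hb' hc h h' r r' hd hi hd' hi' hv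
  refine P_all_union ha hb ha' hb' h h' 1 c r r' isAlgebraic_one hc ⟨hd, fun x hx => ?_⟩ ⟨hd', hi'⟩ hv
  simp only [hi hx, one_mul]

end Summit.KontsevichZagierPeriods.FermatIsogeny.BetaLinearSector.HalvesThirds

end
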